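import Summits.CriticalPhenomena.CardyFormulaZ2.Theses.CardyWickAnisotropy
import Summits.CriticalPhenomena.CardyFormulaZ2.Theorems.CardyWickAnisotropyVitaliStep
import Summits.CriticalPhenomena.CardyFormulaZ2.Theorems.CardyWickAnisotropyRealAxisDictionary
import Summits.CriticalPhenomena.CardyFormulaZ2.Theorems.CardyWickAnisotropyAnisotropicBoxCardyStubHalfPlanePrimitive
import Summits.CriticalPhenomena.CardyFormulaZ2.Theorems.CardyWickAnisotropyAnisotropicBoxCardyStubKzPrimitive
import Summits.CriticalPhenomena.CardyFormulaZ2.Theorems.CardyWickAnisotropyAnisotropicBoxCardyStubAngleMap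
import Summits.CriticalPhenomena.CardyFormulaZ2.Theorems.CardyWickAnisotropyAnisotropicBoxCardyStubEvenJets
import Summits.CriticalPhenomena.CardyFormulaZ2.Theorems.CardyWickAnisotropyAnisotropicBoxCardyStubFirstJetRusso
import Summits.CriticalPhenomena.CardyFormulaZ2.Theorems.CardyWickAnisotropyAnisotropicBoxCardyStubFirstJetTarget
import Summits.CriticalPhenomena.CardyFormulaZ2.Theorems.CardyWickAnisotropyAnisotropicBoxCardyStubWalshJets
import HarnessLib

/-!
# Birth skeleton for the crux `CardyWickAnisotropy.AnisotropicBoxCardy` — lead's reshape (wave 1, c1)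
(item `stmt-CriticalPhenomena-14309`, route `route-CriticalPhenomena-CardyWickAnisotropy`, sub-problem
`CardyFormulaZ2`; line `birth` registered by the skeleton registrar 2026-08-17, RESHAPED by the line
lead `prover-line-stmt-CriticalPhenomena-14309-0` on 2026-08-17 before wave 1: 3 stubs → 5 stubs, same
composition idea; continuation lead `…-14309-c1-0`, 2026-08-17: 5 → 6 stubs — the generic half-plane
primitive `stub_halfPlanePrimitive` is split off `stub_kzPrimitive`, which becomes the named implication
`Sig.stub_kzPrimitive := Sig.stub_halfPlanePrimitive → Sig.kzPrimitive`; composition unchanged.)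

The crux `X_A`: for every `α ∈ (0, π)`, the `P_(𝕃(α))`-probability of a left–right crossing of the
exactly self-dual box `[0,n+1]×[0,n]` (canonical anisotropic critical weights `criticalWeightI (α/2)` /
`criticalWeightI ((π-α)/2)` on horizontal / vertical bonds of `ℤ²`) tends to Cardy's value
`Π_h (cot (α/2)) = cardyFunction (((θ₂/θ₃)(i·cot(α/2)))⁴)`.

## The line (the route's own Wick rotation of the anisotropy, cut one level finer)

`V n p` denotes the complex-anisotropy crossing amplitude of the box (weight `p` on horizontal,
`1 - p` on vertical bonds; a polynomial in `p`), `D = ball (1/2) (1/2)` the disc whose real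
diameter `(0,1)` is the whole critical line `p_h + p_v = 1`, `ℍ = {τ | 0 < im τ}`.

* `stub_discNormality` — **normality on compacta of `D`**: `sup_n sup_{‖2p-1‖ ≤ ρ} ‖V n p‖ < ∞`
  for every `ρ < 1`.  This is the route item `DiscNormality` (stmt-CriticalPhenomena-10255) BY NAME
  (open).
* `stub_halfPlanePrimitive` — **holomorphic functions on `ℍ` have primitives** (generic complex
  analysis: `ℍ` is the increasing union of the discs `B(iR, R)`, Mathlib's
  `DifferentiableOn.isExactOn_ball` on each disc, primitives normalised at `i` agree on the nested
  discs; or the wedge integral from `i` with change of base point as in the tree's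
  `ObliqueRBMWedgeHalfPlane.hasDerivAt_phi`).
* `stub_kzPrimitive` — **the Cardy side as a holomorphic function of `τ ∈ ℍ`** (Kleban–Zagier §3,
  pure special functions), FROM `stub_halfPlanePrimitive`: there is `Φ` holomorphic on `ℍ` with
  `Φ (i r) = Π_h (r)` for every `r > 0`.
  Construction: `Φ(τ) = 1/2 + (iπ·cardyConst/3) ∫_i^τ θ₃(s)⁴ ρ(s)^{1/3} ds`, `ρ = λ(1-λ) = θ₂⁴θ₄⁴/θ₃⁸`
  (tree: `KlebanZagier.rhoC`, zero-free and holomorphic on `ℍ`, `ρ′ = ρ·v`), the cube root through a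
  holomorphic logarithm `L = log ρ(i) + ∫_i^τ v` (wedge-integral primitives on `ℍ`, Mathlib
  `Complex.IsConservativeOn.hasDerivAt_wedgeIntegral` + change of base point as in the tree's
  `ObliqueRBMWedgeHalfPlane`), and the identification on the axis by the ODE
  `(d/dt) F(λ(it)) = -(π cardyConst/3) ρ(it)^{1/3} θ₃(it)⁴` (`hasDerivAt_cardyFunction_lamR`,
  `λθ₄⁴ = ρθ₃⁴`) with `F(λ(i)) = F(1/2) = 1/2`.
* `stub_angleMap` — **the conformal change of variable `p ↦ τ`**: there is `T` holomorphic on `D`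
  with `T(D) ⊆ ℍ` and `T (criticalWeight (α/2)) = i·cot(α/2)` for `α ∈ (0,π)`.  Construction:
  `M(p) = (1 - p ω̄)/(1 - p ω)`, `ω = e^{iπ/3}`; `|M(p) - 2ω|² < 3 ⟺ |p - 1/2| < 1/2` (exact), so on
  `D` `M` takes values in the disc `B(2ω, √3)` ⊆ {0 < arg < 2π/3}; `T = (1 + M^{3/2})/(1 - M^{3/2})`
  (principal power), `Im T = 2 Im M^{3/2}/|1 - M^{3/2}|² > 0`; on the segment
  `M(criticalWeight(α/2)) = e^{2iα/3}` (with `ζ = e^{iα/3}`: `S - sin(α/3)ω̄ = (√3/2)ζ`,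
  `S - sin(α/3)ω = (√3/2)ζ⁻¹`, `S = sin(α/3) + sin((π-α)/3)`), so `M^{3/2} = e^{iα}` and
  `T = (1 + e^{iα})/(1 - e^{iα}) = i cot(α/2)`.
  `stub_halfPlanePrimitive ∧ stub_kzPrimitive ∧ stub_angleMap ⟹ Sig.stub_cardyContinuation` (`G = Φ ∘ T`, glue
  `cardyContinuation_of` below, sorry-free).
* `stub_evenJets` — **even jets at the self-dual square** (provable now): for any holomorphic `G` on
  `D` with the Cardy values on the segment and every EVEN `k`, `iteratedDeriv k (V n) (1/2) →
  iteratedDeriv k G (1/2)`: `k = 0` is `V n (1/2) = 1/2 = F(λ(i)) = G(1/2)` (landed `SelfDuality`,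
  `criticalWeight_pi_div_four`, `lamR_inv`, `cardyFunction_one_sub_holds`); for even `k ≥ 2` both
  sides vanish: `V n p + V n (1-p) = 1` (landed `SelfDuality`) and `G p + G (1-p) = 1` on `D`
  (identity theorem from the segment: `criticalWeight_pi_div_two_sub`, `lamR_inv`,
  `cardyFunction_one_sub_holds`).
* `stub_oddJets` — **odd jets** (the percolation heart, open): the same for ODD `k`; `k = 1` is
  `E_½[N^piv_h − N^piv_v](R_n) → 2√3·(−Π_h′(1)) = 1.80219…`, odd `k ≥ 3` are iterated-Russo twisted
  pivotal moments.  `stub_evenJets ∧ stub_oddJets ⟹ Sig.stub_jetConvergence` (glue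
  `jetConvergence_of`, parity split, sorry-free).

`Sig.stub_cardyContinuation ∧ Sig.stub_jetConvergence` is the route item `TaylorIdentification`
(stmt-CriticalPhenomena-14427); the composition `AnisotropicBoxCardy_of` runs the LANDED Vitali step
`Theorems.vitaliStep_proof : DiscNormality → TaylorIdentification → RealAxisDictionary →
AnisotropicBoxCardy` with the LANDED `Theorems.realAxisDictionary_proof`.  AFTER WAVE 1 (lead c1,
2026-08-17): stubs 2a, 2b, 3, 4 are LANDED theorems of the tree (p144105, p144160, p145582, p144061,
imported above and used by name), so the sorries are exactly TWO — `stub_discNormality` and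
`stub_oddJets` — and (lead c1) `AnisotropicBoxCardy_of : DiscNormality → Sig.stub_oddJets → AnisotropicBoxCardy`
concluded the crux BY NAME.
RESHAPE c2 (lead `…-14309-c2-0`, 2026-08-17): `stub_oddJets` is split along the route's foreseen
second layer into `stub_firstJetRusso` (Russo: `(V n)′(1/2)` = signed pivotal expectation; provable
now), `stub_firstJetTarget` (`G′(1/2) = c₁ = 2√3·(−Π_h′(1)) = 1.80219…`; provable now),
`stub_firstTwistedMoment` (`E_½[N^piv_h − N^piv_v](R_n) → c₁`; OPEN, k = 1) and `stub_oddJetsHigh`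
(odd k ≥ 3; OPEN), glued by `oddJets_of`; the registered composition is now
`AnisotropicBoxCardy_of : DiscNormality → Sig.stub_firstJetRusso → Sig.stub_firstJetTarget →
Sig.stub_firstTwistedMoment → Sig.stub_oddJetsHigh → AnisotropicBoxCardy` (5 stubs ≤ stubs_max 7).
Consolidation in the tree: `Theorems/CardyWickAnisotropyAnisotropicBoxCardyReduction.lean`
(`cardySideContinuation` = existence half of TaylorIdentification, unconditional;
`taylorIdentification_of_oddJets`; `taylorIdentification_of_discNormality_of_anisotropicBoxCardy` =
tightness: given DiscNormality the crux, TaylorIdentification and the odd jets are equivalent).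

Disproof used: none on file for this crux (`ledger crux ls stmt-CriticalPhenomena-14309`: no
Disproof.lean, no Negative lemmas, 2026-08-17T05:20Z).
-/

namespace Summit.CriticalPhenomena.CardyFormulaZ2.Cruxes.AnisotropicBoxCardy.Birth

open scoped Classical
open Summit.CriticalPhenomena.CardyFormulaZ2.Theses.CardyWickAnisotropy
  (DiscNormality TaylorIdentification RealAxisDictionary VitaliStep)

/-! ### Stub signatures (inline `let` prefixes copied verbatim from the route file, so that
`Sig.stub_cardyContinuation ∧ Sig.stub_jetConvergence` unfolds to the text of `TaylorIdentification`) -/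

/-- Signature of the derived statement `cardyContinuation` (no longer a stub; it follows from
`stub_halfPlanePrimitive`, `stub_kzPrimitive` and `stub_angleMap`): the Cardy side `p ↦ Π_h (cot (α(p)/2))` has a holomorphic
continuation `G` from the critical segment `(0,1)` to the disc `D = ball (1/2) (1/2)`. -/
def Sig.stub_cardyContinuation : Prop :=
  let PiH : ℝ → ℝ := fun r ↦ Literature.Probability.RandomPlanarGeometry.cardyFunction (((Literature.NumberTheory.EllipticCurves.JacobiThetaNull.theta2 (Complex.I * (r : ℂ)) / Literature.NumberTheory.EllipticCurves.JacobiThetaNull.theta3 (Complex.I * (r : ℂ))) ^ 4).re); ∃ G : ℂ → ℂ, DifferentiableOn ℂ G (Metric.ball ((1:ℂ) / 2) (1 / 2)) ∧ ∀ α ∈ Set.Ioo (0:ℝ) Real.pi, G ((Literature.Probability.LatticeModels.criticalWeight (α / 2) : ℝ) : ℂ) = ((PiH (Real.cos (α / 2) / Real.sin (α / 2)) : ℝ) : ℂ)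

/-- Signature of `stub_halfPlanePrimitive`: every function holomorphic on the open upper
half-plane `ℍ = {τ | 0 < im τ}` has a holomorphic primitive there (Cauchy–Goursat on the simply
connected `ℍ`; generic, no thetanulls involved). -/
def Sig.stub_halfPlanePrimitive : Prop :=
  ∀ f : ℂ → ℂ, DifferentiableOn ℂ f {τ : ℂ | 0 < τ.im} →
    ∃ g : ℂ → ℂ, ∀ τ : ℂ, 0 < τ.im → HasDerivAt g (f τ) τ

/-- The Kleban–Zagier primitive statement (conclusion of `stub_kzPrimitive`): the Cardy side
`r ↦ Π_h(r) = F(λ(ir))` is the restriction to the positive imaginary axis of a function `Φ`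
holomorphic on the upper half-plane (Kleban–Zagier 2003 §3: `dΦ/dτ ∝ η(τ)⁴ ∝ θ₃⁴ (λ(1-λ))^{1/3}`). -/
def Sig.kzPrimitive : Prop :=
  let PiH : ℝ → ℝ := fun r ↦ Literature.Probability.RandomPlanarGeometry.cardyFunction (((Literature.NumberTheory.EllipticCurves.JacobiThetaNull.theta2 (Complex.I * (r : ℂ)) / Literature.NumberTheory.EllipticCurves.JacobiThetaNull.theta3 (Complex.I * (r : ℂ))) ^ 4).re); ∃ Φ : ℂ → ℂ, DifferentiableOn ℂ Φ {τ : ℂ | 0 < τ.im} ∧ ∀ r : ℝ, 0 < r → Φ (Complex.I * (r : ℂ)) = ((PiH r : ℝ) : ℂ)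

/-- Signature of `stub_kzPrimitive` as run by its worker (reshape c1): the Kleban–Zagier primitive
GIVEN the generic half-plane primitive, i.e. the named implication
`Sig.stub_halfPlanePrimitive → Sig.kzPrimitive`. -/
def Sig.stub_kzPrimitive : Prop :=
  Sig.stub_halfPlanePrimitive → Sig.kzPrimitive

/-- Signature of `stub_angleMap`: the dictionary `p ↦ τ(p) = i·cot(α(p)/2)` (`p = criticalWeight(α/2)`,
`tan(α/3) = √3 p/(2 - p)`) extends from the segment `(0,1)` to a holomorphic map of the disc
`D = ball (1/2) (1/2)` INTO the upper half-plane. -/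
def Sig.stub_angleMap : Prop :=
  ∃ T : ℂ → ℂ, DifferentiableOn ℂ T (Metric.ball ((1:ℂ) / 2) (1 / 2)) ∧
    (∀ p ∈ Metric.ball ((1:ℂ) / 2) (1 / 2), 0 < (T p).im) ∧
    ∀ α ∈ Set.Ioo (0:ℝ) Real.pi, T ((Literature.Probability.LatticeModels.criticalWeight (α / 2) : ℝ) : ℂ) = Complex.I * ((Real.cos (α / 2) / Real.sin (α / 2) : ℝ) : ℂ)

/-- Signature of the derived statement `jetConvergence` (no longer a stub; it follows from
`stub_evenJets` and `stub_oddJets`): for any holomorphic `G` on `D` continuing the Cardy side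
(unique; exists by `cardyContinuation`), every jet of the amplitude `V n` at the self-dual
square `p = 1/2` converges to the corresponding jet of `G`. -/
def Sig.stub_jetConvergence : Prop :=
  let E : ℕ → Finset (Sym2 (Literature.Probability.LatticeModels.Site 2)) := fun n ↦ ((Literature.Probability.Percolation.rectangle (n + 1) n ×ˢ Literature.Probability.Percolation.rectangle (n + 1) n).filter (fun xy ↦ (Literature.Probability.LatticeModels.zdGraph 2).Adj xy.1 xy.2)).image (fun xy ↦ s(xy.1, xy.2)); let w : ℂ → Sym2 (Literature.Probability.LatticeModels.Site 2) → ℂ := fun p e ↦ if (∃ x y : Literature.Probability.LatticeModels.Site 2, e = s(x, y) ∧ x 1 = y 1) then p else 1 - p; let V : ℕ → ℂ → ℂ := fun n p ↦ ∑ ω ∈ (E n).powerset, (if ((ω : Set (Sym2 (Literature.Probability.LatticeModels.Site 2))) ∈ Literature.Probability.Percolation.lrCrossing (n + 1) n) then ∏ e ∈ E n, (if e ∈ ω then w p e else 1 - w p e) else 0); let PiH : ℝ → ℝ := fun r ↦ Literature.Probability.RandomPlanarGeometry.cardyFunction (((Literature.NumberTheory.EllipticCurves.JacobiThetaNull.theta2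 (Complex.I * (r : ℂ)) / Literature.NumberTheory.EllipticCurves.JacobiThetaNull.theta3 (Complex.I * (r : ℂ))) ^ 4).re); ∀ G : ℂ → ℂ, DifferentiableOn ℂ G (Metric.ball ((1:ℂ) / 2) (1 / 2)) → (∀ α ∈ Set.Ioo (0:ℝ) Real.pi, G ((Literature.Probability.LatticeModels.criticalWeight (α / 2) : ℝ) : ℂ) = ((PiH (Real.cos (α / 2) / Real.sin (α / 2)) : ℝ) : ℂ)) → ∀ k : ℕ, Filter.Tendsto (fun n : ℕ ↦ iteratedDeriv k (V n) ((1:ℂ) / 2)) Filter.atTop (nhds (iteratedDeriv k G ((1:ℂ) / 2)))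

/-- Signature of `stub_evenJets`: the EVEN jets of `V n` at `1/2` converge to those of any
holomorphic continuation `G` of the Cardy side (`k = 0`: both are `1/2`; even `k ≥ 2`: both vanish by
self-duality on the two sides). -/
def Sig.stub_evenJets : Prop :=
  let E : ℕ → Finset (Sym2 (Literature.Probability.LatticeModels.Site 2)) := fun n ↦ ((Literature.Probability.Percolation.rectangle (n + 1) n ×ˢ Literature.Probability.Percolation.rectangle (n + 1) n).filter (fun xy ↦ (Literature.Probability.LatticeModels.zdGraph 2).Adj xy.1 xy.2)).image (fun xy ↦ s(xy.1, xy.2)); let w : ℂ → Sym2 (Literature.Probability.LatticeModels.Site 2) → ℂ := fun p e ↦ if (∃ x y : Literature.Probability.LatticeModels.Site 2, e = s(x, y) ∧ x 1 = y 1) then p else 1 - p; let V : ℕ → ℂ → ℂ := fun n p ↦ ∑ ω ∈ (E n).powerset, (if ((ω : Set (Sym2 (Literature.Probability.LatticeModels.Site 2))) ∈ Literature.Probability.Percolation.lrCrossing (n + 1) n) then ∏ e ∈ E n, (if e ∈ ω then w p e else 1 - w p e) else 0); let PiH : ℝ → ℝ := fun r ↦ Literature.Probability.RandomPlanarGeometry.cardyFunction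 (((Literature.NumberTheory.EllipticCurves.JacobiThetaNull.theta2 (Complex.I * (r : ℂ)) / Literature.NumberTheory.EllipticCurves.JacobiThetaNull.theta3 (Complex.I * (r : ℂ))) ^ 4).re); ∀ G : ℂ → ℂ, DifferentiableOn ℂ G (Metric.ball ((1:ℂ) / 2) (1 / 2)) → (∀ α ∈ Set.Ioo (0:ℝ) Real.pi, G ((Literature.Probability.LatticeModels.criticalWeight (α / 2) : ℝ) : ℂ) = ((PiH (Real.cos (α / 2) / Real.sin (α / 2)) : ℝ) : ℂ)) → ∀ k : ℕ, Even k → Filter.Tendsto (fun n : ℕ ↦ iteratedDeriv k (V n) ((1:ℂ) / 2)) Filter.atTop (nhds (iteratedDeriv k G ((1:ℂ) / 2)))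

/-- Signature of `stub_oddJets`: the ODD jets of `V n` at `1/2` converge to those of any holomorphic
continuation `G` of the Cardy side (`k = 1`: `E_½[N^piv_h − N^piv_v](R_n) → 2√3·(−Π_h′(1))`; odd
`k ≥ 3`: iterated-Russo twisted pivotal moments) — the percolation heart of the line. -/
def Sig.stub_oddJets : Prop :=
  let E : ℕ → Finset (Sym2 (Literature.Probability.LatticeModels.Site 2)) := fun n ↦ ((Literature.Probability.Percolation.rectangle (n + 1) n ×ˢ Literature.Probability.Percolation.rectangle (n + 1) n).filter (fun xy ↦ (Literature.Probability.LatticeModels.zdGraph 2).Adj xy.1 xy.2)).image (fun xy ↦ s(xy.1, xy.2)); let w : ℂ → Sym2 (Literature.Probability.LatticeModels.Site 2) → ℂ := fun p e ↦ if (∃ x y : Literature.Probability.LatticeModels.Site 2, e = s(x, y) ∧ x 1 = y 1) then p else 1 - p; let V : ℕ → ℂ → ℂ := fun n p ↦ ∑ ω ∈ (E n).powerset, (if ((ω : Set (Sym2 (Literature.Probability.LatticeModels.Site 2))) ∈ Literature.Probability.Percolation.lrCrossing (n + 1) n) then ∏ e ∈ E n, (if e ∈ ω then w p e else 1 - w p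 e) else 0); let PiH : ℝ → ℝ := fun r ↦ Literature.Probability.RandomPlanarGeometry.cardyFunction (((Literature.NumberTheory.EllipticCurves.JacobiThetaNull.theta2 (Complex.I * (r : ℂ)) / Literature.NumberTheory.EllipticCurves.JacobiThetaNull.theta3 (Complex.I * (r : ℂ))) ^ 4).re); ∀ G : ℂ → ℂ, DifferentiableOn ℂ G (Metric.ball ((1:ℂ) / 2) (1 / 2)) → (∀ α ∈ Set.Ioo (0:ℝ) Real.pi, G ((Literature.Probability.LatticeModels.criticalWeight (α / 2) : ℝ) : ℂ) = ((PiH (Real.cos (α / 2) / Real.sin (α / 2)) : ℝ) : ℂ)) → ∀ k : ℕ, Odd k → Filter.Tendsto (fun n : ℕ ↦ iteratedDeriv k (V n) ((1:ℂ) / 2)) Filter.atTop (nhds (iteratedDeriv k G ((1:ℂ) / 2)))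


/-! ### Reshape c2 (lead `…-14309-c2-0`, 2026-08-17): `stub_oddJets` is DERIVED from four finer stubs
along the route's own foreseen split `TaylorIdentification ⇐ ContinuationExists (landed) →
FirstTwistedMoment (k = 1) → HigherTwistedMoments (odd k ≥ 3)`, with the k = 1 rung made a pure
percolation statement by two provable dictionary stubs (Russo on the lattice side, the chain rule
through `criticalWeight` and Kleban–Zagier's `λ′ = -πλθ₄⁴` on the Cardy side). -/

/-- Signature of `stub_firstJetRusso` (provable now, exact for every `n`): Russo's formula for the
complex amplitude at the self-dual point — `(d/dp) V n` at `p = 1/2` is the SIGNED pivotal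
expectation `E_½[N^piv_h − N^piv_v](R_n)`, written as the finite count
`Σ_e (±1) · 2·#{ω ⊆ E n ∖ e : ω ∪ e ∈ LR, ω ∉ LR} / 2^|E n|` (`+` on horizontal, `−` on vertical
edges; `lrCrossing` is increasing, `isUpperSet_lrCrossing`). -/
def Sig.stub_firstJetRusso : Prop :=
  let E : ℕ → Finset (Sym2 (Literature.Probability.LatticeModels.Site 2)) := fun n ↦ ((Literature.Probability.Percolation.rectangle (n + 1) n ×ˢ Literature.Probability.Percolation.rectangle (n + 1) n).filter (fun xy ↦ (Literature.Probability.LatticeModels.zdGraph 2).Adj xy.1 xy.2)).image (fun xy ↦ s(xy.1, xy.2)); let w : ℂ → Sym2 (Literature.Probability.LatticeModels.Site 2) → ℂ := fun p e ↦ if (∃ x y : Literature.Probability.LatticeModels.Site 2, e = s(x, y) ∧ x 1 = y 1) then p else 1 - p; let V : ℕ → ℂ → ℂ := fun n p ↦ ∑ ω ∈ (E n).powerset, (if ((ω : Set (Sym2 (Literature.Probability.LatticeModels.Site 2))) ∈ Literature.Probability.Percolation.lrCrossing (n + 1) n) then ∏ e ∈ E n, (if e ∈ ω then w p e else 1 -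 w p e) else 0); let Piv : ℕ → ℝ := fun n ↦ ∑ e ∈ E n, (if (∃ x y : Literature.Probability.LatticeModels.Site 2, e = s(x, y) ∧ x 1 = y 1) then (1:ℝ) else -1) * (2 * ((((E n).erase e).powerset.filter (fun ω ↦ ((↑(insert e ω) : Set (Sym2 (Literature.Probability.LatticeModels.Site 2))) ∈ Literature.Probability.Percolation.lrCrossing (n + 1) n) ∧ ((↑ω : Set (Sym2 (Literature.Probability.LatticeModels.Site 2))) ∉ Literature.Probability.Percolation.lrCrossing (n + 1) n))).card : ℝ) / (2:ℝ) ^ (E n).card); ∀ n : ℕ, deriv (V n) ((1:ℂ) / 2) = ((Piv n : ℝ) : ℂ)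

/-- Signature of `stub_firstJetTarget` (provable now, special functions): every holomorphic `G` on
`D` with the Cardy values on the critical segment has
`G′(1/2) = c₁ := 2√3 · (cardyConst/3) · (1/4)^(-2/3) · (π/2) · θ₄(i)⁴ = 2√3 · (−Π_h′(1)) = 1.80219…`
(chain rule along `α ↦ criticalWeight (α/2)` at `α = π/2`, where `(d/dα) criticalWeight (α/2) = √3/6`,
`(d/dα) cot (α/2) = -1`, and `Π_h′(1)` from `KlebanZagier.hasDerivAt_lamR`, `lamR_one`,
`hasDerivAt_cardyFunction_holds`, `modularLambdaI_eq_lamR`). -/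
def Sig.stub_firstJetTarget : Prop :=
  let PiH : ℝ → ℝ := fun r ↦ Literature.Probability.RandomPlanarGeometry.cardyFunction (((Literature.NumberTheory.EllipticCurves.JacobiThetaNull.theta2 (Complex.I * (r : ℂ)) / Literature.NumberTheory.EllipticCurves.JacobiThetaNull.theta3 (Complex.I * (r : ℂ))) ^ 4).re); let c₁ : ℝ := 2 * Real.sqrt 3 * (Literature.Probability.RandomPlanarGeometry.cardyConst / 3) * (1 / 4 : ℝ) ^ (-(2 / 3 : ℝ)) * (Real.pi / 2) * (Literature.NumberTheory.EllipticCurves.JacobiThetaNull.theta4 Complex.I).re ^ 4; ∀ G : ℂ → ℂ, DifferentiableOn ℂ G (Metric.ball ((1:ℂ) / 2) (1 / 2)) → (∀ α ∈ Set.Ioo (0:ℝ) Real.pi, G ((Literature.Probability.LatticeModels.criticalWeight (α / 2) : ℝ) : ℂ) = ((PiH (Real.cos (α / 2) / Real.sin (α / 2)) : ℝ) : ℂ)) → deriv G ((1:ℂ) / 2) = ((c₁ : ℝ) : ℂ)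

/-- Signature of `stub_firstTwistedMoment` (OPEN — the k = 1 rung, the route's `FirstTwistedMoment`,
shared falsifier with route CardyStressTensorWard): the signed pivotal expectation of the self-dual
box at `p = 1/2` converges to `c₁ = 1.80219…` (exact n ≤ 8: 1.375 … 1.720; MC n = 32: 1.784 ± 0.005). -/
def Sig.stub_firstTwistedMoment : Prop :=
  let E : ℕ → Finset (Sym2 (Literature.Probability.LatticeModels.Site 2)) := fun n ↦ ((Literature.Probability.Percolation.rectangle (n + 1) n ×ˢ Literature.Probability.Percolation.rectangle (n + 1) n).filter (fun xy ↦ (Literature.Probability.LatticeModels.zdGraph 2).Adj xy.1 xy.2)).image (fun xy ↦ s(xy.1, xy.2)); let Piv : ℕ → ℝ := fun n ↦ ∑ e ∈ E n, (if (∃ x y : Literature.Probability.LatticeModels.Site 2, e = s(x, y) ∧ x 1 = y 1) then (1:ℝ) else -1) * (2 * ((((E n).erase e).powerset.filter (fun ω ↦ ((↑(insert e ω) : Set (Sym2 (Literature.Probability.LatticeModels.Site 2))) ∈ Literature.Probability.Percolation.lrCrossing (n + 1) n) ∧ ((↑ω : Set (Sym2 (Literature.Probability.LatticeModels.Site 2)))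 ∉ Literature.Probability.Percolation.lrCrossing (n + 1) n))).card : ℝ) / (2:ℝ) ^ (E n).card); let c₁ : ℝ := 2 * Real.sqrt 3 * (Literature.Probability.RandomPlanarGeometry.cardyConst / 3) * (1 / 4 : ℝ) ^ (-(2 / 3 : ℝ)) * (Real.pi / 2) * (Literature.NumberTheory.EllipticCurves.JacobiThetaNull.theta4 Complex.I).re ^ 4; Filter.Tendsto (fun n : ℕ ↦ Piv n) Filter.atTop (nhds c₁)

/-- Signature of `stub_oddJetsHigh` (OPEN — the route's `HigherTwistedMoments`): the odd jets of
order `k ≥ 3` of `V n` at `1/2` converge to those of any holomorphic continuation `G` of the Cardy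
side (iterated-Russo twisted pivotal moments). -/
def Sig.stub_oddJetsHigh : Prop :=
  let E : ℕ → Finset (Sym2 (Literature.Probability.LatticeModels.Site 2)) := fun n ↦ ((Literature.Probability.Percolation.rectangle (n + 1) n ×ˢ Literature.Probability.Percolation.rectangle (n + 1) n).filter (fun xy ↦ (Literature.Probability.LatticeModels.zdGraph 2).Adj xy.1 xy.2)).image (fun xy ↦ s(xy.1, xy.2)); let w : ℂ → Sym2 (Literature.Probability.LatticeModels.Site 2) → ℂ := fun p e ↦ if (∃ x y : Literature.Probability.LatticeModels.Site 2, e = s(x, y) ∧ x 1 = y 1) then p else 1 - p; let V : ℕ → ℂ → ℂ := fun n p ↦ ∑ ω ∈ (E n).powerset, (if ((ω : Set (Sym2 (Literature.Probability.LatticeModels.Site 2))) ∈ Literature.Probability.Percolation.lrCrossing (n + 1) n) then ∏ e ∈ E n, (if e ∈ ω then w p e else 1 - w p e) else 0); let PiH : ℝ → ℝ := fun r ↦ Literature.Probability.RandomPlanarGeometry.cardyFunction (((Literature.NumberTheory.EllipticCurves.JacobiThetaNull.theta2 (Complex.I * (r : ℂ)) / Literature.NumberTheory.EllipticCurves.JacobiThetaNull.theta3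 (Complex.I * (r : ℂ))) ^ 4).re); ∀ G : ℂ → ℂ, DifferentiableOn ℂ G (Metric.ball ((1:ℂ) / 2) (1 / 2)) → (∀ α ∈ Set.Ioo (0:ℝ) Real.pi, G ((Literature.Probability.LatticeModels.criticalWeight (α / 2) : ℝ) : ℂ) = ((PiH (Real.cos (α / 2) / Real.sin (α / 2)) : ℝ) : ℂ)) → ∀ k : ℕ, Odd k → 3 ≤ k → Filter.Tendsto (fun n : ℕ ↦ iteratedDeriv k (V n) ((1:ℂ) / 2)) Filter.atTop (nhds (iteratedDeriv k G ((1:ℂ) / 2)))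


/-! ### Reshape c2b (lead `…-14309-c2-0`, 2026-08-17): `stub_oddJetsHigh` is DERIVED from the twisted
Fourier–Walsh dictionary (provable, all `n`, `k`) and the convergence of the odd twisted LEVEL SUMS
`W_k(n)` (open) — the route's own language for the lattice side ("the odd twisted level sums
W_(2k+1)(n)"): `V n ((1+z)/2) = Σ_T z^|T| (−1)^(v T) Â_n(T)`, `Â_n(T) = 2^(−|E n|) Σ_ω 1_LR(ω) (−1)^|T∖ω|`
the Fourier–Walsh coefficient of the crossing indicator at `p = 1/2`, `v T` = number of vertical edges
in `T`; hence `iteratedDeriv k (V n) (1/2) = k!·2^k·W_k(n)`, `W_k(n) = Σ_(|T| = k) (−1)^(v T) Â_n(T)`. -/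

/-- Signature of `stub_walshJets` (provable now, exact for all `n k`): the jets of `V n` at the
self-dual point are the twisted Fourier–Walsh level sums, `iteratedDeriv k (V n) (1/2) = k!·2^k·W n k`
with `W n k = Σ_(T ⊆ E n, |T| = k) (−1)^#(vertical edges of T) · (2^(−|E n|) Σ_(ω ⊆ E n) 1[ω ∈ LR]·(−1)^|T ∖ ω|)`
(expand `Π_e (1 + z·τ_e(ω))/2`, `τ_e(ω) = ±1`, at `p = (1+z)/2`). -/
def Sig.stub_walshJets : Prop :=
  let E : ℕ → Finset (Sym2 (Literature.Probability.LatticeModels.Site 2)) := fun n ↦ ((Literature.Probability.Percolation.rectangle (n + 1) n ×ˢ Literature.Probability.Percolation.rectangle (n + 1) n).filter (fun xy ↦ (Literature.Probability.LatticeModels.zdGraph 2).Adj xy.1 xy.2)).image (fun xy ↦ s(xy.1, xy.2)); let w : ℂ → Sym2 (Literature.Probability.LatticeModels.Site 2) → ℂ := fun p e ↦ if (∃ x y : Literature.Probability.LatticeModels.Site 2, e = s(x, y) ∧ x 1 = y 1) then p else 1 - p; let V : ℕ → ℂ → ℂ := fun n p ↦ ∑ ω ∈ (E n).powerset, (if ((ω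 : Set (Sym2 (Literature.Probability.LatticeModels.Site 2))) ∈ Literature.Probability.Percolation.lrCrossing (n + 1) n) then ∏ e ∈ E n, (if e ∈ ω then w p e else 1 - w p e) else 0); let W : ℕ → ℕ → ℝ := fun n k ↦ ∑ T ∈ (E n).powersetCard k, (-1 : ℝ) ^ (T.filter (fun e ↦ ¬ ∃ x y : Literature.Probability.LatticeModels.Site 2, e = s(x, y) ∧ x 1 = y 1)).card * ((∑ ω ∈ (E n).powerset, (if ((ω : Set (Sym2 (Literature.Probability.LatticeModels.Site 2))) ∈ Literature.Probability.Percolation.lrCrossing (n + 1) n) then (-1 : ℝ) ^ (T \ ω).card else 0)) / (2 : ℝ) ^ (E n).card); ∀ n k : ℕ, iteratedDeriv k (V n) ((1:ℂ) / 2) = (((k.factorial : ℝ) * 2 ^ k * W n k : ℝ) : ℂ)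

/-- Signature of `stub_oddLevelSums` (OPEN — the route's `HigherTwistedMoments` in level-sum form): for
every holomorphic continuation `G` of the Cardy side and every odd `k ≥ 3`, the rescaled twisted level
sums `k!·2^k·W n k` converge to `iteratedDeriv k G (1/2)`. -/
def Sig.stub_oddLevelSums : Prop :=
  let E : ℕ → Finset (Sym2 (Literature.Probability.LatticeModels.Site 2)) := fun n ↦ ((Literature.Probability.Percolation.rectangle (n + 1) n ×ˢ Literature.Probability.Percolation.rectangle (n + 1) n).filter (fun xy ↦ (Literature.Probability.LatticeModels.zdGraph 2).Adj xy.1 xy.2)).image (fun xy ↦ s(xy.1, xy.2)); let W : ℕ → ℕ → ℝ := fun n k ↦ ∑ T ∈ (E n).powersetCard k, (-1 : ℝ) ^ (T.filter (fun e ↦ ¬ ∃ x y : Literature.Probability.LatticeModels.Site 2, e = s(x, y) ∧ x 1 = y 1)).card * ((∑ ω ∈ (E n).powerset, (if ((ω : Set (Sym2 (Literature.Probability.LatticeModels.Site 2))) ∈ Literature.Probability.Percolation.lrCrossing (n + 1) n) then (-1 : ℝ) ^ (T \ ω).card else 0)) / (2 : ℝ) ^ (E n).card); let PiH : ℝ →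 ℝ := fun r ↦ Literature.Probability.RandomPlanarGeometry.cardyFunction (((Literature.NumberTheory.EllipticCurves.JacobiThetaNull.theta2 (Complex.I * (r : ℂ)) / Literature.NumberTheory.EllipticCurves.JacobiThetaNull.theta3 (Complex.I * (r : ℂ))) ^ 4).re); ∀ G : ℂ → ℂ, DifferentiableOn ℂ G (Metric.ball ((1:ℂ) / 2) (1 / 2)) → (∀ α ∈ Set.Ioo (0:ℝ) Real.pi, G ((Literature.Probability.LatticeModels.criticalWeight (α / 2) : ℝ) : ℂ) = ((PiH (Real.cos (α / 2) / Real.sin (α / 2)) : ℝ) : ℂ)) → ∀ k : ℕ, Odd k → 3 ≤ k → Filter.Tendsto (fun n : ℕ ↦ ((((k.factorial : ℝ) * 2 ^ k * W n k : ℝ)) : ℂ)) Filter.atTop (nhds (iteratedDeriv k G ((1:ℂ) / 2)))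

/-! ### The stubs -/

/-- stub 1 — NORMALITY on compacta of `D` = the route item `DiscNormality`
(stmt-CriticalPhenomena-10255) by name: `∀ ρ < 1, ∃ C, ∀ n p, ‖2p − 1‖ ≤ ρ → ‖V n p‖ ≤ C`. -/
theorem stub_discNormality : DiscNormality := by
  sorry

/-- stub 2a — holomorphic functions on the upper half-plane have primitives (generic).
LANDED (wave 1, p144105): `Theorems/CardyWickAnisotropyAnisotropicBoxCardyStubHalfPlanePrimitive.lean`. -/
theorem stub_halfPlanePrimitive : Sig.stub_halfPlanePrimitive :=
  Summit.CriticalPhenomena.CardyFormulaZ2.Theorems.stub_halfPlanePrimitive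

/-- stub 2b — GIVEN primitives on `ℍ`, the Cardy side `Π_h` is the axis restriction of a holomorphic
function on `ℍ` (Kleban–Zagier primitive `Φ′ = (cardyConst/3)·λ′·ρ^{-2/3}`, `ρ^{-2/3} = exp(-(2/3)L)`,
`L′ = ρ′/ρ = v`, `L(i) = log ρ(i)`; identification on the axis by the real ODE and `F(λ(i)) = 1/2`). -/
theorem stub_kzPrimitive : Sig.stub_kzPrimitive :=
  -- LANDED (wave 1, p144160): `Theorems/CardyWickAnisotropyAnisotropicBoxCardyStubKzPrimitive.lean`
  Summit.CriticalPhenomena.CardyFormulaZ2.Theorems.stub_kzPrimitive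

/-- stub 3 — the weight-to-modulus dictionary `p ↦ i·cot(α(p)/2)` is holomorphic `D → ℍ`
(elementary: Möbius map, principal `3/2` power).
LANDED (wave 1, p145582): `Theorems/CardyWickAnisotropyAnisotropicBoxCardyStubAngleMap.lean`. -/
theorem stub_angleMap : Sig.stub_angleMap :=
  Summit.CriticalPhenomena.CardyFormulaZ2.Theorems.stub_angleMap

/-- stub 4 — even jets of `V n` at `1/2` converge to those of the continuation (self-duality on
both sides).
LANDED (wave 1, p144061): `Theorems/CardyWickAnisotropyAnisotropicBoxCardyStubEvenJets.lean`. -/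
theorem stub_evenJets : Sig.stub_evenJets :=
  Summit.CriticalPhenomena.CardyFormulaZ2.Theorems.stub_evenJets

/-- stub 5a — Russo's formula at the self-dual point: `(V n)′(1/2)` is the signed pivotal
expectation (exact for every `n`).
LANDED (wave 1 of lead c2, p150362): `Theorems/CardyWickAnisotropyAnisotropicBoxCardyStubFirstJetRusso.lean`. -/
theorem stub_firstJetRusso : Sig.stub_firstJetRusso :=
  Summit.CriticalPhenomena.CardyFormulaZ2.Theorems.stub_firstJetRusso

/-- stub 5b — the k = 1 Cardy target: `G′(1/2) = c₁ = 2√3·(−Π_h′(1))` for every holomorphic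
continuation `G` of the Cardy side.
LANDED (wave 1 of lead c2, p150113): `Theorems/CardyWickAnisotropyAnisotropicBoxCardyStubFirstJetTarget.lean`. -/
theorem stub_firstJetTarget : Sig.stub_firstJetTarget :=
  Summit.CriticalPhenomena.CardyFormulaZ2.Theorems.stub_firstJetTarget

/-- stub 5c — the first twisted moment (OPEN, k = 1): `E_½[N^piv_h − N^piv_v](R_n) → c₁`. -/
theorem stub_firstTwistedMoment : Sig.stub_firstTwistedMoment := by
  sorry

/-- stub 5d₁ — the twisted Fourier–Walsh dictionary for all jets.
LANDED (wave 2 of lead c2, p152211): `Theorems/CardyWickAnisotropyAnisotropicBoxCardyStubWalshJets.lean`. -/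
theorem stub_walshJets : Sig.stub_walshJets :=
  Summit.CriticalPhenomena.CardyFormulaZ2.Theorems.stub_walshJets

/-- stub 5d₂ — convergence of the odd twisted level sums `k!·2^k·W n k`, odd `k ≥ 3` (OPEN). -/
theorem stub_oddLevelSums : Sig.stub_oddLevelSums := by
  sorry

/-- `stub_oddJetsHigh` DERIVED (reshape c2b): rewrite the jets of `V n` as level sums
(`stub_walshJets`) and apply `stub_oddLevelSums`. -/
theorem oddJetsHigh_of : Sig.stub_walshJets → Sig.stub_oddLevelSums → Sig.stub_oddJetsHigh := by
  intro hW hL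
  dsimp only [Sig.stub_walshJets] at hW
  dsimp only [Sig.stub_oddLevelSums] at hL
  dsimp only [Sig.stub_oddJetsHigh]
  intro G hG hval k hk h3
  simp_rw [hW]
  exact hL G hG hval k hk h3

/-- stub 5d — the higher odd jets (odd k ≥ 3), now the composition of 5d₁ and 5d₂. -/
theorem stub_oddJetsHigh : Sig.stub_oddJetsHigh :=
  oddJetsHigh_of stub_walshJets stub_oddLevelSums

/-- `stub_oddJets` DERIVED (reshape c2): k = 1 from Russo + target + first twisted moment
(`iteratedDeriv_one`, continuity of `ℝ → ℂ`), odd k ≥ 3 from `stub_oddJetsHigh`. -/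
theorem oddJets_of :
    Sig.stub_firstJetRusso → Sig.stub_firstJetTarget → Sig.stub_firstTwistedMoment →
      Sig.stub_oddJetsHigh → Sig.stub_oddJets := by
  intro hR hT hM hH
  dsimp only [Sig.stub_firstJetRusso] at hR
  dsimp only [Sig.stub_firstJetTarget] at hT
  dsimp only [Sig.stub_firstTwistedMoment] at hM
  dsimp only [Sig.stub_oddJetsHigh] at hH
  dsimp only [Sig.stub_oddJets]
  intro G hG hval k hk
  by_cases h3 : 3 ≤ k
  · exact hH G hG hval k hk h3
  · obtain ⟨j, rfl⟩ := hk
    have hj : j = 0 := by omega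
    subst hj
    simp only [Nat.mul_zero, Nat.zero_add, iteratedDeriv_one]
    simp_rw [hR, hT G hG hval]
    exact (Complex.continuous_ofReal.tendsto _).comp hM

/-- stub 5 — odd jets of `V n` at `1/2` converge to those of the continuation (percolation heart),
now the composition of stubs 5a–5d. -/
theorem stub_oddJets : Sig.stub_oddJets :=
  oddJets_of stub_firstJetRusso stub_firstJetTarget stub_firstTwistedMoment stub_oddJetsHigh

/-! ### Sorry-free glue -/

/-- `cardyContinuation` from stubs 2a, 2b and 3: `G = Φ ∘ T` is holomorphic on `D` (chain rule,
`T(D) ⊆ ℍ`) and `G (criticalWeight (α/2)) = Φ (i·cot(α/2)) = Π_h (cot (α/2))` since `cot (α/2) > 0`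
on `(0,π)`. -/
theorem cardyContinuation_of :
    Sig.stub_halfPlanePrimitive → Sig.stub_kzPrimitive → Sig.stub_angleMap →
      Sig.stub_cardyContinuation := by
  intro hP hPK hT
  have hK : Sig.kzPrimitive := hPK hP
  dsimp only [Sig.kzPrimitive] at hK
  obtain ⟨Φ, hΦ, hΦax⟩ := hK
  obtain ⟨T, hT, hTim, hTval⟩ := hT
  dsimp only [Sig.stub_cardyContinuation]
  refine ⟨Φ ∘ T, hΦ.comp hT (fun p hp => hTim p hp), ?_⟩
  intro α hα
  have h1 : 0 < Real.cos (α / 2) :=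
    Real.cos_pos_of_mem_Ioo ⟨by linarith [hα.1, Real.pi_pos], by linarith [hα.2]⟩
  have h2 : 0 < Real.sin (α / 2) :=
    Real.sin_pos_of_pos_of_lt_pi (by linarith [hα.1]) (by linarith [hα.2, Real.pi_pos])
  have hr : 0 < Real.cos (α / 2) / Real.sin (α / 2) := div_pos h1 h2
  simp only [Function.comp_apply]
  rw [hTval α hα, hΦax _ hr]

/-- `jetConvergence` from stubs 4 and 5 (parity split). -/
theorem jetConvergence_of :
    Sig.stub_evenJets → Sig.stub_oddJets → Sig.stub_jetConvergence := by
  intro hE hO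
  dsimp only [Sig.stub_evenJets] at hE
  dsimp only [Sig.stub_oddJets] at hO
  dsimp only [Sig.stub_jetConvergence]
  intro G hG hval k
  rcases Nat.even_or_odd k with hk | hk
  · exact hE G hG hval k hk
  · exact hO G hG hval k hk

/-! ### The composition (sorry-free): the OPEN registered stubs give the crux BY NAME

Exactly ONE theorem in this file concludes the crux with hypotheses (the skeleton audit analyses the
first crux-concluding theorem it meets): `AnisotropicBoxCardy_of`. History of the composition:
registrar (3 stubs: discNormality, cardyContinuation, jetConvergence) → lead c0/c1 (6 stubs:
discNormality, halfPlanePrimitive, kzPrimitive, angleMap, evenJets, oddJets; 4 landed in wave 1 of c1)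
→ lead c2 reshape (oddJets ⇐ firstJetRusso + firstJetTarget + firstTwistedMoment + oddJetsHigh; the
first two landed in wave 1 of c2) → reshape c2b (oddJetsHigh ⇐ walshJets + oddLevelSums). -/

/-- **`AnisotropicBoxCardy` from exactly its OPEN registered stubs** (lead c2, after wave 2):
`DiscNormality` (route item stmt-CriticalPhenomena-10255), the first twisted moment
`stub_firstTwistedMoment` (k = 1) and the odd twisted level sums `stub_oddLevelSums` (odd k ≥ 3) —
three research-grade percolation statements. The LANDED stubs are discharged inside by name
(halfPlanePrimitive p144105, kzPrimitive p144160, angleMap p145582 → continuation `G = Φ ∘ T` via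
`cardyContinuation_of`; evenJets p144061; firstJetRusso p150362, firstJetTarget p150113 and walshJets
p152211 → odd jets via `oddJets_of` / `oddJetsHigh_of`; parity glue `jetConvergence_of`), then the
landed Vitali step `vitaliStep_proof` with `realAxisDictionary_proof`. -/
theorem AnisotropicBoxCardy_of :
    DiscNormality → Sig.stub_firstTwistedMoment → Sig.stub_oddLevelSums →
      Summit.CriticalPhenomena.CardyFormulaZ2.Theses.CardyWickAnisotropy.AnisotropicBoxCardy := by
  intro hN hM hL
  have hC : Sig.stub_cardyContinuation :=
    cardyContinuation_of stub_halfPlanePrimitive stub_kzPrimitive stub_angleMap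
  have hO : Sig.stub_oddJets :=
    oddJets_of stub_firstJetRusso stub_firstJetTarget hM (oddJetsHigh_of stub_walshJets hL)
  have hJ : Sig.stub_jetConvergence := jetConvergence_of stub_evenJets hO
  -- Vitali step (landed): DiscNormality → TaylorIdentification → RealAxisDictionary → AnisotropicBoxCardy
  have hV : VitaliStep := Summit.CriticalPhenomena.CardyFormulaZ2.Theorems.vitaliStep_proof
  unfold VitaliStep at hV
  refine hV hN ?_ Summit.CriticalPhenomena.CardyFormulaZ2.Theorems.realAxisDictionary_proof
  -- TaylorIdentification from the continuation and the jets
  dsimp only [Sig.stub_cardyContinuation] at hC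
  dsimp only [Sig.stub_jetConvergence] at hJ
  dsimp only [TaylorIdentification]
  obtain ⟨G, hG, hval⟩ := hC
  exact ⟨G, hG, hval, hJ G hG hval⟩

/-- The crux modulo exactly the registered stubs, by name (sorries live only in `stub_*`; this
zero-hypothesis form is what becomes the closing theorem once the four stubs are theorems). -/
theorem AnisotropicBoxCardy_of_stubs :
    Summit.CriticalPhenomena.CardyFormulaZ2.Theses.CardyWickAnisotropy.AnisotropicBoxCardy :=
  AnisotropicBoxCardy_of stub_discNormality stub_firstTwistedMoment stub_oddLevelSums

end Summit.CriticalPhenomena.CardyFormulaZ2.Cruxes.AnisotropicBoxCardy.Birth
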